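import Mathlib
import HarnessLib
import HarnessLib.Audit
import Summits.Langlands.Statement
import Literature.NumberTheory.GaloisRepresentations.LabelledHodgeTateWeights
import Literature.NumberTheory.GaloisRepresentations.CrystallineDeformationRing
import Literature.NumberTheory.Automorphic.LocalLanglandsDatumProofs
import Summits.Langlands.Langlands.Theorems.TriangulineChamberWallLemma
import HarnessLib.Audit.Status.Attr

/-!
Route: TriangulineChamber

DORMANT since 2026-08-22T05:25:23Z (reconciler: no traction for 5.1 d (last activity item-evidence-added at 2026-08-17T02:29:45Z); parked, not closed — `ledger route dormant route-Langlands-TriangulineChamber --off` to reactivate) — unstaffed, not closed; items shared with open routes are served there. `ledger route dormant <id> --off` reactivates.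

# Route TriangulineChamber — one irreducible trianguline chamber per torsion type replaces p-adic
local Langlands in all-weight GL2 lifting at F_v beyond Q_p

It suffices to show X = IRR'' ∧ SEEDS, where IRR''(ρ̄_v, t) (card
Langlands/Langlands/one-chamber-per-type-trianguline, CORRECTED here) says: for a finite K/ℚ_p, a
generic ρ̄_v : G_K → GL₂(k) (ρ̄_v^ss not of the form χ ⊕ χω^i, i ∈ {0, ±1}) and a torsion type t ∈
Hom(μ(K)², L×) = π₀ of the character space 𝒯² of (K×)², the Breuil–Hellmann–Schraen trianguline
variety X_tri^□(ρ̄_v) has AT MOST ONE irreducible component over the type-t component of 𝒯² which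
contains a regular (strictly dominant) crystalline point of U_tri^reg and whose generic Galois
representation is irreducible (the closure Z_B of the Borel-valued lifts with their tautological
triangulation is a separate, metrically open union of "ordinary" components and is excluded — this
is the correction to the card's IRR'); SEEDS says every such chamber, and every ordinary component,
carries an automorphic point of the patched eigenvariety X_p(ρ̄). By BHS (arXiv:1411.7260 Thm 3.20,
Conj 3.22, Prop 3.27) X gives crystalline modularity in EVERY regular weight for definite unitary
groups with F⁺_v ARBITRARY, hence the typed target LiftB2CrysGeneric: automorphy lifting for GL₂
over totally real F, 7 ≤ p with ANY ramification in F, ρ crystalline Hodge–Tate regular at every v ∣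
p with generic residual restriction, ρ̄|F(ζ_p) absolutely irreducible, residually automorphic (RD
pinned by the conjoined (A)-direction and by the Hodge–Tate weights of the powers of the cyclotomic
character) — the arbitrary-weight sector at F_v ≠ ℚ_p that the barrier ModPLanglandsGL2BeyondQpFpBar
says no local correspondence reaches (known today only for F_v = ℚ_p, Kisin2009, and F_v = ℚ_{p²}
very generic, arXiv:2512.04641).
Lean: `∀ (F : Type) [Field F] [NumberField F] [NumberField.IsTotallyReal F] (p : ℕ) [Fact p.Prime],
7 ≤ p → ∃ RD : ReciprocityData F, (∀ (m : ℤ) (χ :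
Literature.NumberTheory.GaloisRepresentations.FramedGaloisRep F (PadicAlgCl p) 1), (∀ σ, (χ σ).val 0
0 = algebraMap ℚ_[p] (PadicAlgCl p)
((((Literature.NumberTheory.GaloisRepresentations.GaloisRep.cyclotomicCharacter F p σ : ℤ_[p]ˣ) :
ℤ_[p]) : ℚ_[p]) ^ m)) → ∀ (v : IsDedekindDomain.HeightOneSpectrum (NumberField.RingOfIntegers F))
(hv : ((p : ℕ) : NumberField.RingOfIntegers F) ∈ v.asIdeal), let D := RD.pst p v hv; letI :=
D.algebra; ∀ τ : v.adicCompletion F →ₐ[ℚ_[p]] PadicAlgCl p, χ.labelledHodgeTateWeightsAt v D.algebra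
D.𝔅 τ.toRingHom = {-m}) ∧ ∀ hcpt :
Literature.NumberTheory.Automorphic.isCompact_glFiniteIntegralLevel 2 F, (∀ π :
Literature.NumberTheory.Automorphic.CuspidalAutomorphicRepData 2 F hcpt, π.1.IsLAlgebraic → (∃ T :
Literature.NumberTheory.Automorphic.InfinityType F 2, π.1.HasInfinityType T ∧ T.IsRegular) → ∀ (ℓ :
ℕ) [Fact ℓ.Prime] (ι : PadicAlgCl ℓ ≃+* ℂ), ∃ ρ :
Literature.NumberTheory.GaloisRepresentations.FramedGaloisRep F (PadicAlgCl ℓ) 2,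
ρ.toGaloisRep.IsIrreducible ∧ IsGeometricFramed RD ρ ∧ Corresponds RD ι π.1 ρ) ∧ (∀ (ι : PadicAlgCl
p ≃+* ℂ) (ρ : Literature.NumberTheory.GaloisRepresentations.FramedGaloisRep F (PadicAlgCl p) 2),
ρ.toGaloisRep.IsIrreducible → IsGeometricFramed RD ρ → ρ.IsOdd → (∀ (v :
IsDedekindDomain.HeightOneSpectrum (NumberField.RingOfIntegers F)) (hv : ((p : ℕ) :
NumberField.RingOfIntegers F) ∈ v.asIdeal), let D := RD.pst p v hv; D.IsCrystallineFramed (ρ.toLocal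
v) ∧ (letI := D.algebra; ∀ τ : v.adicCompletion F →ₐ[ℚ_[p]] PadicAlgCl p, let M :=
ρ.labelledHodgeTateWeightsAt v D.algebra D.𝔅 τ.toRingHom; M.Nodup ∧ Multiset.card M = 2)) → (∀ v :
IsDedekindDomain.HeightOneSpectrum (NumberField.RingOfIntegers F), ((p : ℕ) :
NumberField.RingOfIntegers F) ∈ v.asIdeal → ∀ χ₁ χ₂ : Field.absoluteGaloisGroup (v.adicCompletion F)
→* (PadicAlgCl p)ˣ, IsOpen (χ₁.ker : Set (Field.absoluteGaloisGroup (v.adicCompletion F))) → IsOpen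
(χ₂.ker : Set (Field.absoluteGaloisGroup (v.adicCompletion F))) → (∀ σ, ‖(ρ.toLocal v σ).val.trace -
((χ₁ σ : PadicAlgCl p) + (χ₂ σ : PadicAlgCl p))‖ < 1) → (∃ σ, 1 ≤ ‖(χ₁ σ : PadicAlgCl p) * (χ₂ σ :
PadicAlgCl p)⁻¹ - 1‖) ∧ (∃ σ, 1 ≤ ‖(χ₁ σ : PadicAlgCl p) * (χ₂ σ : PadicAlgCl p)⁻¹ - algebraMap
ℚ_[p] (PadicAlgCl p) (((Literature.NumberTheory.GaloisRepresentations.GaloisRep.cyclotomicCharacter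
(v.adicCompletion F) p σ : ℤ_[p]ˣ) : ℤ_[p]) : ℚ_[p])‖)) → (¬ ∃ χ₁ χ₂ : Field.absoluteGaloisGroup
(CyclotomicField p F) →* (PadicAlgCl p)ˣ, IsOpen (χ₁.ker : Set (Field.absoluteGaloisGroup
(CyclotomicField p F))) ∧ IsOpen (χ₂.ker : Set (Field.absoluteGaloisGroup (CyclotomicField p F))) ∧
∀ σ, ‖(ρ.restrictField (CyclotomicField p F) σ).val.trace - ((χ₁ σ : PadicAlgCl p) + (χ₂ σ :
PadicAlgCl p))‖ < 1) → (∃ (π₀ : Literature.NumberTheory.Automorphic.CuspidalAutomorphicRepData 2 F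
hcpt) (ρ₀ : Literature.NumberTheory.GaloisRepresentations.FramedGaloisRep F (PadicAlgCl p) 2),
π₀.1.IsLAlgebraic ∧ (∃ T : Literature.NumberTheory.Automorphic.InfinityType F 2,
π₀.1.HasInfinityType T ∧ T.IsRegular) ∧ Corresponds RD ι π₀.1 ρ₀ ∧ ∀ σ, ‖(ρ σ).val.trace - (ρ₀
σ).val.trace‖ < 1) → ∃ π : Literature.NumberTheory.Automorphic.CuspidalAutomorphicRepData 2 F hcpt,
π.1.IsLAlgebraic ∧ Corresponds RD ι π.1 ρ)`

## Assembly
Pure logic at the typed layer: case split on whether p divides disc F (LiftB2CrysUnramifiedP,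
LiftB2CrysRamifiedP ⇒ LiftB2CrysGeneric; `assembly_holds` compiles in the planner's Sketch.lean).
The MATHEMATICAL assembly "IRR'' + SEEDS ⇒ each typed slice" is the informal support
BHSChamberAssembly (filed after open, in print except IRR''): IRR''(ρ̄_ṽ, t) ∀ v ∣ p, t +
OrdinaryComponent + TypeSeeds ⇒ BHS Conj 3.22 for (ρ̄, U^p, S = S_p ∪ {v₁}) ⇒ (Prop 3.27) Conj 3.24
⇒ automorphy of every lift of ρ̄ crystalline strictly dominant at v ∣ p for the definite unitary
group (p > 2n+1 = 5, ρ̄(G_{F(ζ_p)}) adequate ⇐ absolutely irreducible for p ≥ 7,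
GuralnickHerzigTiep2017) ⇒ GL₂ over totally real F by the standard solvable base change /
polarisation / descent yoga (BarnetlambEtAl2014 §2, §4; Thm 4.3.1 and Taylor's Ihara avoidance seed
the components at v ∤ p) ⇒ weak automorphy ⇒ Corresponds via the conjoined (A)-direction (Chebotarev
+ Brauer–Nesbitt).

Rationale: WHY THIS LINE. Mechanism (card one-chamber-per-type-trianguline): replace "classify
Banach/supersingular representations of GL₂(K)" (barrier) and "find a potentially diagonalisable
point on every component of every fixed-weight crystalline deformation ring" (route WachCensus) by
ONE connectivity statement per torsion type about rank-1 (φ,Γ)-modules and a single Ext¹: p-adic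
interpolation (BreuilHellmannSchraen2017Trianguline Thm 3.20: the patched eigenvariety is a union of
irreducible components of X_tri × 𝔛^p × 𝕌^g; Prop 3.27: Conj 3.22 ⇒ crystalline modularity 3.24 ⇔
refined Breuil–Mézard, Rem 3.25) glues the infinitely many fixed-weight π₀-problems into one per
type. Imported areas: rigid/adic geometry of eigenvarieties (Coleman–Mazur component question;
Liu–Wan–Xiao halo; the ghost theorem of Liu–Truong–Xiao–Zhao arXiv:2302.07697, whose §9 proves the
fibrewise form of the K = ℚ_p, ρ̄_v reducible-nonsplit very-generic case of IRR'' — the non-ordinary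
spectral curve of a primitive arithmetic module of type ρ̄_v is irreducible per character of
(𝔽_p×)², and their Theorem 'X_tri = X' identifies Emerton's Jacquet module of the Paškūnas family
with the BHS trianguline space — and whose Remark after the §9 Corollary 'irreducible components'
(items 144–146 of the sequential numbering) asks the split m = 2 case and the general "primitive ⇒
irreducible" principle), Zariski density/irreducibility of local deformation rings
(BockleIyengarPaskunas2023, Chenevier2011, Nakamura), Taylor–Wiles–Kisin patching (CaraianiEtAl2016,
HellmannMargerinSchraen2022). What the line does that prior routes do not: WachCensus works weight
by weight with explicit Wach/Kisin-module reductions for UNRAMIFIED F_v and extra-regular weights;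
NewtonPatching/CMFern use global trianguline spaces for direction (A)/(B) over CM fields; none
isolates per-type irreducibility of the LOCAL trianguline variety as the crux, and none covers
ramified F_v. Negatives index: one refuted Langlands statement (K3KugaSatakeDescent.SerreTypeAnchor,
a vacuous-quantifier defect) — unrelated; the typed statements here bind p prime, 7 ≤ p, and pin RD
by the conjoined (A)-direction exactly as the audited Statement (brief V8).

RANKED CRUXES. Ranks 2 and 3 are INFORMAL cruxes (no closed Lean signature is possible today: over
the landed interface Literature.NumberTheory.GaloisRepresentations.TriangulineVariety every `∀ X,
hyps → …` form of IRR'' is junk-false by re-topologisation and every ∃X form junk-true — crux-attack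
on 8599, JunkRetopologize.lean; they get signatures as `∀ t, X.IrredChamberAt d 𝔇 t` once definition
D2 and a characterisation of the genuine X_tri^□(ρ̄) exist): #2 IrredChamberGL2 — IRR''(ρ̄_v, t) for
every finite K/ℚ_p, n = 2, generic ρ̄_v (the heart; why it might fail: a further invariant constant
on positive-slope components, e.g. partial-embedding phenomena for [K:ℚ_p] ≥ 2; sources
arXiv:1411.7260, arXiv:1702.02192, arXiv:2302.07697); #3 ChamberQpIrreducible (item
stmt-Langlands-8601, REPAIRED 2026-08-16 from ChamberQpOpenCases after the crux-attack verdict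
refuted-misstated) — IRR'' for K = ℚ_p and ρ̄ absolutely irreducible (ρ̄|_{I_p} ≅ ω₂^s ⊕ ω₂^{ps},
(p+1) ∤ s, p ≥ 5): for EVERY torsion type t AT MOST ONE irreducible component of X_tri^□(ρ̄) over
𝒯²_t carries a regular crystalline strictly dominant φ-generic point (Z_B = ∅ here; vacuous at the
(p−1)(p−2) det-incompatible types whose fibre is empty — the old 'exactly one … for every ε' was
literally false there; non-emptiness is TypeSeeds' job) (why it might fail: no structure theory for
the supersingular block — no ghost series, LTXZ II p.5 'the smallest slope at a classical point
seems to depend on the automorphic data', even finiteness of π₀ is the open Coleman–Mazur question;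
sources arXiv:2302.07697 p.5/§1.5, arXiv:1411.7260, arXiv:2508.02761). The SPLIT generic case of the
old #3 is no longer a crux: by the refuter's Ribet-segment correspondence (LTXZ II §7.3 pp. 56–57
made global, their Rem 122(2)) it reduces to the nonsplit neighbour and is filed as support
ChamberQpSplit (ChamberQpNonsplit → IRR''(χ̄₁ ⊕ χ̄₂, t)); LTXZ II Rem 146 (is Spc_nord irreducible
for split r̄_p and arithmetic modules with m = 2?) is CONTEXT only — a question about
abstract/global modules with no local object behind it (Assumption 123, Rem 122(2); Thm 126 'X_tri =
X' is nonsplit-only), logically independent of IRR''. Supports (informal): ChamberQpNonsplit (LTXZ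
II §9 Cor 145 m = 1 + Thm 126: known modulo the Jacquet-functor dictionary), ChamberQpSplit
(transfer lemma, M on paper), OrdinaryComponent, TypeSeeds, BHSChamberAssembly (stmt-Langlands-8610:
an informal SUPPORT — the mathematical glue IRR'' ∧ OrdinaryComponent ∧ TypeSeeds ⇒ slices — that
the gate badged `assembly` at filing; the typed Assembly stmt-Langlands-8577 is the route's single
assembly; OPERATOR: rebadge 8610 to support). The superseded ChamberQpOpenCases
(stmt-Langlands-8601) stays in the file demoted to support and HELD (not staffed) only because
`--drop` is bounced by route.multi-assembly while 8610 carries the assembly badge; OPERATOR: drop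
it. GLUE (rev 9, 2026-08-16): the deciding theorem is now crux-only — `closes (_hG :
LiftB2CrysGeneric) (hU : LiftB2CrysUnramifiedP) (hR : LiftB2CrysRamifiedP) (hJ : SliceToLanglands) :
Langlands` with the p ∣ disc F case split inlined — as the gate lint glue.non-crux-hypothesis
demands; hence SliceToLanglands (stmt-Langlands-9516, the declared OUT-OF-SCOPE remainder
LiftB2CrysGeneric → Langlands) is badged crux and HELD by design (not claimed, not to be staffed
from this route), and the target LiftB2CrysGeneric is auto-badged crux (conjecture-grade) by the
gate. Staffing cruxes proper: IrredChamberGL2 (2), ChamberQpIrreducible (3), LiftB2CrysUnramifiedP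
(4), LiftB2CrysRamifiedP (5). Typed blocks:
#0 LiftB2CrysGeneric (target) — (B)-direction lifting slice for n = 2 over totally real F: for every
prime p ≥ 7 (ANY ramification in F) there are reciprocity data RD, pinned by the conjoined known
(A)-direction for regular L-algebraic cuspidal π of GL₂/F AND by the labelled Hodge–Tate weights
{−m} of every power ε^m of the cyclotomic character at every v ∣ p and every ℚ_p-embedding (this
second pin defeats junk filtrations on RD.pst.𝔅 — e.g. Fil^i = B for i ≤ 0, 0 for i > 0 — that would
make the regularity hypothesis unsatisfiable and the slice vacuous), such that every irreducible,
geometric, totally odd ρ : G_F → GL₂(ℚ̄_p) which at every v ∣ p is crystalline (de Rham, WD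
unramified, N = 0 through RD.pst) with multiplicity-free τ-labelled Hodge–Tate weights of
cardinality 2 for every ℚ_p-embedding τ, whose residual restriction at every v ∣ p is generic (no
trace congruence to χ₁ + χ₂ with χ₁χ₂⁻¹ ≡ 1 or ≡ ε), with ρ̄|G_{F(ζ_p)} absolutely irreducible and
ρ̄ ≡ ρ₀ for the ρ₀ of a regular L-algebraic cuspidal π₀, corresponds (Corresponds RD ι π ρ) to an
L-algebraic cuspidal π. (why it might fail: It is all-weight automorphy lifting at F_v ≠ ℚ_p; known
only for F_v = ℚ_p (Kisin2009) and F_v = ℚ_{p²} very generic (arXiv:2512.04641); the ∃RD shape also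
needs the unproved LocalLanglandsDatum/PstWeilDeligneData nonempty facts.) [Kisin2009,
arXiv:2512.04641, BreuilHellmannSchraen2017Trianguline, BuzzardGeeLMS2014]
#4 LiftB2CrysUnramifiedP (crux) — the target slice restricted to primes p UNRAMIFIED in F (¬ p ∣
disc F): every F_v is ℚ_{p^f}; the first layer beyond print is f_v ≥ 3 (f_v = 1: Kisin2009; f_v = 2
very generic: Matsumoto arXiv:2512.04641 Thm 1.2). In the mechanism this is the regime where torsion
types are tame (μ(F_v) = μ_{q−1}), Fontaine–Laffaille seeds exist in every residue class of weights,
and halo/ghost technology is partially available (Ren–Zhao arXiv:2005.14267). [difficulty: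
open-problem] (why it might fail: For f ≥ 3 no classicality theorem (Matsumoto's two conjectures
open) and no ghost/halo theory; IRR'' may fail for [K:ℚ_p] ≥ 2 through an invariant of the extension
class relative to partial-embedding sub-bundles of H¹(δ₁δ₂⁻¹), giving ≥ 2 chambers per type.)
[arXiv:2512.04641, arXiv:2005.14267, BreuilHellmannSchraen2019, Kisin2009]
#5 LiftB2CrysRamifiedP (crux) — the target slice for primes p RAMIFIED in F (p ∣ disc F): some
F_v/ℚ_p is ramified; here Breuil–Mézard is known only for potentially Barsotti–Tate types
(GeeKisin2014), the perfectoid classicality method uses unramifiedness crucially (arXiv:2512.04641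
Rem 1.1), and torsion types acquire a μ_{p^∞}(F_v)-part (matching the determinant components of the
framed deformation ring, Böckle–Iyengar–Paškūnas arXiv:2110.01638). [difficulty: open-problem] (why
it might fail: Ramified K: no Fontaine–Laffaille seeds, types carry a μ_{p^∞}(K)-part, and discrete
Breuil–Kisin lattice invariants (already splitting fixed-weight pot-BT deformation rings for large
e, GeeKisin2014) could persist across weights and cut a type into several chambers; nothing beyond
pot-BT is known.) [GeeKisin2014, arXiv:2110.01638, arXiv:2512.04641,
BreuilHellmannSchraen2017Trianguline]
#9 LiftB2CrysSplitP (support) — the target slice when p SPLITS COMPLETELY in F (every F_v = ℚ_p):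
KNOWN in print — Kisin's Fontaine–Mazur theorem for GL₂ over totally real fields in which p splits
completely (via Breuil–Mézard for GL₂(ℚ_p) and Colmez's functor; the residual genericity here
excludes exactly Kisin's bad cases). Calibration anchor and formal sanity target (it is a
specialisation of LiftB2CrysGeneric, proved in Sketch.lean: splitP_of_generic). [difficulty: XL]
[Kisin2009, CaraianiEtAl2016, Emerton2011LocalGlobal]
#9 WallLemma (support) — the adic WALL LEMMA behind the comb picture of the card (P1a): a Laurent
series Σ a_n z^n over a complete ultrametric field, power-bounded by 1 on the OPEN annulus r < |z| <
1 (sup over r < s < 1 of ‖a_n‖ s^n ≤ 1), has constant reduction there: ‖f(x) − a_0‖ < 1 for every r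
< ‖x‖ < 1 (so ρ̄^ss, read through bounded analytic traces, is constant on chambers and the reduction
walls of the fixed-weight charts sit at removed Gauss points). Mathlib-sized
(NonarchimedeanAddGroup.summable_of_tendsto_cofinite_zero + ultrametric tsum bound); explanatory,
not load-bearing for the Assembly. [difficulty: provable-now] [BreuilHellmannSchraen2017Trianguline,
KedlayaPottharstXiao2014]

TWO-LAYER PLAN. Foreseen glued splits (nothing filed now): IrredChamberGL2 ⇐ (K = ℚ_p:
ChamberQpNonsplit [in print] + ChamberQpSplit [transfer] + ChamberQpIrreducible [open]) → (K =
ℚ_{p²}, where Conj 3.24 is now known by arXiv:2512.04641 + EmertonGee2022 so 3.22 holds and IRR''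
can be tested against it) → (general K); LiftB2CrysUnramifiedP ⇐ (all f_v ≤ 2) → (some f_v ≥ 3) →
glue by case split on residue degrees (the WachCensus pattern); LiftB2CrysRamifiedP ⇐ (ζ_p ∉ F_v for
all v ∣ p: tame types only) → (general).

KILL CRITERIA. ChamberQpIrreducible refuted — an explicit SECOND seeded positive-slope chamber
(irreducible component of X_tri^□(ρ̄) with a regular crystalline strictly dominant φ-generic point)
over one det-compatible type for an irreducible ρ̄ over ℚ_p, e.g. read off an explicit eigencurve
computation — kills IRR'' in its calibration case: close `refuted:IrredChamberGL2` unless the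
separating invariant is finite and each chamber is seedable (then PIVOT to 'finitely many chambers
per type, one Fontaine–Laffaille/automorphic seed each' — a census line to be merged with
WachCensus). IrredChamberGL2 refuted for some K (e.g. ℚ_{p²}) by an explicit second chamber: same.
ChamberQpSplit refuted (the transfer fails: a split-generic ρ̄ over ℚ_p with two seeded chambers
over one type while the nonsplit neighbour has one) would equally kill IrredChamberGL2. RETIRED kill
criterion (crux-attack 2026-08-16): 'two ghost-type Fredholm factors of multiplicity 1 for the split
universal module' — no such local m = 2 module exists in print (LTXZ II Assumption 123, Rem 122(2)),
and a factorisation of Spc_nord for a GLOBAL m = 2 module (Rem 146) would not refute IRR''. A typed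
slice refuted would contradict Fontaine–Mazur (not expected); a slice found junk-witnessable or
vacuous ⇒ restate, not close. LiftB2CrysGeneric proved elsewhere (e.g. the perfectoid classicality
programme reaching all ℚ_{p^f} and ramified F_v) ⇒ close superseded; IRR'' keeps independent value
(refined Breuil–Mézard, Coleman–Mazur component question) and would be re-filed under a structure
route.

NOT DECOMPOSED YET. The informal heart (IrredChamberGL2, ChamberQpIrreducible) and the supports
(ChamberQpNonsplit, ChamberQpSplit, OrdinaryComponent, TypeSeeds, BHSChamberAssembly) are filed by
`workitem add --informal` because rigid/adic spaces, (φ,Γ)-modules over Robba rings, definite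
unitary automorphic forms and patched modules are absent from the tree; the definition request D1
(TriangulineVariety interface) has LANDED, but a closed signature for IRR'' additionally needs the
predicate D2 IrredChamberAt and a characterisation of the genuine BHS space (DEFINITION REQUESTS).
Deliberately NOT decomposed: n ≥ 3 ("one chamber per (type, parabolic)"), non-generic ρ̄_v,
irregular weights, the refined Breuil–Mézard corollary, the K = ℚ_{p²} rung, the halo description
for [K:ℚ_p] ≥ 2, and the transport lemmas (ReciprocityData along F_v ≅ (F′)_w) shared with
LiftDescend/WachCensus.

CHEAPEST FALSIFIER. (1) Literature, minutes: an explicit eigencurve / trianguline-variety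
computation localised at an IRREDUCIBLE ρ̄|G_{ℚ_p} (Buzzard–Kilford p = 2, Roe p = 3,
Coleman–Stevens–Teitelbaum, Bergdall–Pollack slope data at Buzzard-irregular ρ̄; LTXZ II §1.5 and
p.5 for the state of the art) exhibiting TWO rigid components through supersingular-residual points
of one type over one weight disc kills ChamberQpIrreducible, hence IRR''. Run so far: LTXZ II read
(pp. 5, 13, 56–57, 68–69: reducible r̄_p only; irreducible case 'not investigated'); crux-attacks on
8599/8601 (2026-08-16) searched the arXiv sequels (Hur arXiv:2508.02761 nonsplit-only; the rest
conjectural) — nothing decides it; searchd/OpenAlex were unavailable (rc 75) during this repair,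
logged. (2) For ChamberQpSplit no falsifier cheaper than a proof attempt exists (its nonsplit input
is in print). RETIRED: the PARI residue test along the two lowest ghost sheets for split-at-p
newforms (refuter g44-0: not a decision procedure, and its natural population is CM-congruent where
irreducibility is provable) and the Rem 146 literature watch (independent of IRR'').

NUMBERS. dim X_tri^□(ρ̄_v) = n² + [K:ℚ_p]·n(n+1)/2 (= 4 + 3[K:ℚ_p] for n = 2), equidimensional,
U_tri^reg smooth Zariski-open dense (BreuilHellmannSchraen2017Trianguline Th 2.6); dim of the
Borel-valued locus = dim 𝔟·([K:ℚ_p]+1) + dim G/B = the same number (whence OrdinaryComponent). Types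
for K = ℚ_{p^f}, p > 2: (q−1)² characters of μ_{q−1}², of which q−1 are compatible with det ρ̄_v;
Fontaine–Laffaille seeds reach only O(2^f) of them, algebraic weights ⊗_τ Sym^{n_τ} ⊗ det^{c_τ} with
n_τ ≥ q²−1 reach all (TypeSeeds). LTXZ range: p ≥ 11, 2 ≤ a ≤ p−5 (arXiv:2302.07697 §9). Matsumoto
range: p ≥ 5, F_v ∈ {ℚ_p, ℚ_{p²}}, all Serre weights with 2 ≤ k_{τ,1} − k_{τ,2} ≤ p−5
(arXiv:2512.04641 Thm 1.2, 1.5). Typed slices: 7 ≤ p (adequacy for n = 2, GuralnickHerzigTiep2017).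
Items after the 2026-08-16 repair: 8 typed (target — auto-badged crux by the gate as
conjecture-grade —, 2 crux slices, 4 supports incl. ReciprocityDataInputs/SliceToLanglands, the
single typed Assembly) + 7 live informal (cruxes IrredChamberGL2, ChamberQpIrreducible; supports
ChamberQpNonsplit, ChamberQpSplit, OrdinaryComponent, TypeSeeds, BHSChamberAssembly) = 15 ≤ 15, plus
the superseded HELD ChamberQpOpenCases awaiting an operator drop; ledger badges: 6 crux (incl. the
auto-badged target and the held out-of-scope SliceToLanglands), 1 typed assembly + the mis-badged
informal 8610.

DEFINITION REQUESTS. D1 TriangulineVariety — LANDED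
(Literature/NumberTheory/GaloisRepresentations/TriangulineVariety.lean +
TriangulineVarietyProofs.lean: the datum Pt/topology/galoisRep/param/regular, type strata clopen,
point predicates
IsCrystallineAt/IsHodgeTateRegularAt/IsStrictlyDominantAt/IsPhiGenericAt/IsBorelValuedAt/IsSlopeZeroAt,
property predicates
IsEquidimensional/RegularIsOpenDense/PointsOfRegular/HasAllRegularPoints/BorelLocusClopen). Its
docstring displays IRR'' as `{C ∈ irreducibleComponents X.Pt | C ⊆ X.typeStratum t ∧ ¬ C ⊆ closure
{x | X.IsBorelValuedAt d x} ∧ ∃ x ∈ C ∩ X.regular, X.IsCrystallineAt 𝔇 x ∧ X.IsHodgeTateRegularAt 𝔇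
x ∧ X.IsStrictlyDominantAt x ∧ X.IsPhiGenericAt 𝔇 x}.Subsingleton`, but quantified `∀ X, hyps → …`
this is junk-false (re-topologise the clopen positive-slope part: crux-attack on 8599,
JunkRetopologize.lean) and `∃ X` junk-true. D2 (filed with this repair as defn-IrredChamberAt, --for
stmt-Langlands-14538) IrredChamberAt: the displayed Subsingleton formula as a PREDICATE
`TriangulineVariety.IrredChamberAt (X) (d) (𝔇) (t) : Prop` with X explicit (like BorelLocusClopen),
so that BHSChamberAssembly-type consumers take `(hIRR : ∀ t, X.IrredChamberAt d 𝔇 t)` as a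
hypothesis on a datum; a closed statement of IrredChamberGL2 / ChamberQpIrreducible further needs a
characterisation predicate of the genuine BHS space (points AND analytic Zariski topology — rigid
geometry), not requested yet. Cite facts wanted later (untypable today): BHS Prop 3.27 (3.22 ⇒
3.24), BHS 2019 companion-points theorem, LTXZ II §9 Cor 145 / Thm 126.

Novelty: Searches (2026-08-15): lit search --source arxiv "ghost conjecture slopes eigencurve irreducible
components Liu Truong Xiao Zhao" (1: arXiv:2302.07697, READ pp. 5–7, 68–69); "locally analytic
vectors completed cohomology unitary Shimura curves" (3: arXiv:2505.10290 READ pp. 1–3,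
arXiv:2512.04641 READ pp. 1–5, arXiv:2201.12922); "ghost conjecture slopes modular forms" (8:
Bergdall–Pollack ×4, arXiv:2508.02761 READ abstract, arXiv:2207.12145, LTXZ II); "spectral halo
Hilbert modular forms" (1: arXiv:2005.14267); "eigenvariety irreducible components" (11:
arXiv:1703.03568, arXiv:1801.04719 READ pp. 1–3, arXiv:1411.7260, …); "trianguline variety
irreducible components" (0); "trianguline deformation space components" (1: arXiv:0911.5726);
"density automorphic points deformation rings polarized" (2: arXiv:1601.03752, arXiv:1811.09116);
"Breuil-Mezard conjecture unramified GL2" (0); lit galaxy search --star all "irreducible components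
of the eigencurve" / "completed cohomology of unitary Shimura curves" / "locally analytic vectors of
the completed cohomology of unitary Shimura curves" (0, 0, 0; --star pdf "components of the
eigencurve": 1, arXiv:0912.2925); arXiv:1411.7260 READ pp. 28–30 (Thm 3.20, Def 3.21, Conj 3.22, Rem
3.23, Conj 3.24, Rem 3.25, Prop 3.26, 3.27) + grep of hypotheses pp. 3–18; the card's own searches
(zbMATH ×3, galaxy ×2, 108 Ideas cards) inherited. searchd was unavailable (rc 75) for
zbMATH/OpenAlex during part of the session — logged in NOTES.
Nearest prior ar  [refs: 2302.07697, 2505.10290, 2512.04641, 2201.12922, 2508.02761, 2207.12145, 2005.14267, 1703.03568, 1801.04719, 1411.7260, 0911.5726, 1601.03752, 1811.09116, 0912.2925, 2110.01638, HellmannMargerinSchraen2022, BockleIyengarPaskunas2023]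

Barriers (technique_class: adic-connectivity, trianguline-chambers, patching): - technique_class: adic-connectivity, trianguline-chambers, patching
- Literature.Barriers.Langlands.ModPLanglandsGL2BeyondQpFpBar: evaded — no mod p / p-adic local
Langlands correspondence for GL₂(F_v) is used or built; the objects are characters of F_v×, one
Robba-ring Ext¹ and the adic geometry of X_tri, and the automorphic input is the patched module only
through BHS Thm 3.20 (support = union of components). Note for the catalogue: its "nothing beyond
ℚ_p" scope is now dated by arXiv:2512.04641 (F_v = ℚ_{p²}, very generic), also without a local
correspondence.
- Literature.Barriers.Langlands.BreuilPaskunas2012_supersingularFamily: evaded for the same reason —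
the infinite supersingular families are invisible to rank-1 parameters and types.
- Literature.Barriers.Langlands.ModPLanglandsGL2BeyondQp: (deprecated mis-stated form) same.
- Literature.Barriers.Langlands.PatchingLocalComponentBarrier: engaged head-on, not evaded —
patching still certifies one component at a time; the bet is that p-adic interpolation (BHS Thm 3.20
+ IRR'') makes every relevant local component visible from ONE automorphic seed per type
(TypeSeeds), i.e. visibility ACROSS weights replaces potential diagonalisability within a weight.
- Literature.Barriers.Langlands.TaylorWilesNumericalCoincidence: not evaded — the whole assembly
lives in the definite unitary (l₀ = 0) setting of CaraianiEtAl2016/BHS and reaches GL₂ over totally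
real F by solvable base change; nothing is claimed in positive defect.
- Li

History (route lifecycle, newest last):
- 2026-08-16T03:54:41Z · AUTO-CRUX (edit): LiftB2CrysGeneric — hypotheses of the deciding theorem that nothing in the route derives are cruxes (planner-rrefute-Langlands-TriangulineChamber-s-a996770a-0)
- 2026-08-16T14:43:07Z · LINT AUTOFIX route.multi-assembly: kept Assembly, dropped Assembly2 (gate:hygiene)
- 2026-08-22T05:25:23Z · DORMANT — reconciler: no traction for 5.1 d (last activity item-evidence-added at 2026-08-17T02:29:45Z); parked, not closed — `ledger route dormant route-Langlands-Triang (operator:999:1958287)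

sub-problem: Langlands · status: dormant · opened planner-plancard-Langlands-Langlands-one-cham-7b8ae78e-0 2026-08-15T13:15:20Z · rev 11 · ledger route-Langlands-TriangulineChamber
GENERATED by the gate from the ledger (D-0016/17). Provers cite these decls: `theorem foo : Summit.Langlands.Langlands.Theses.TriangulineChamber.<Decl> := …` in Summits/Langlands/Langlands/Theorems/<Name>.lean.
-/

namespace Summit.Langlands.Langlands.Theses.TriangulineChamber

open scoped BigOperators Topology Manifold Classical MeasureTheory ProbabilityTheory Matrix InnerProductSpace ComplexConjugate ContinuousMap
open Filter Set Function TopologicalSpace MeasureTheory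

attribute [summit_statement] _root_.Langlands

/-- item stmt-Langlands-8572 · crux (kind.auto-crux: conjecture-grade) · rank 0 · open · by planner
why it might fail: All-weight crystalline lifting at F_v ≠ ℚ_p: open beyond F_v = ℚ_p (Kisin2009), ℚ_{p²} very generic (arXiv:2512.04641), small generic weights (arXiv:2310.07006); as typed 'crystalline' is RD.pst-relative (junk IsWeilDeligneOf weakens (B)); ∃RD waits on LocalLanglandsDatum/PstWeilDeligneData.nonempty
sources: Kisin2009, arXiv:2512.04641, arXiv:2310.07006, BreuilHellmannSchraen2017Trianguline, BuzzardGeeLMS2014, Literature.NumberTheory.GaloisRepresentations.PstWeilDeligneData.nonempty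
[target] (B)-direction lifting slice for n = 2 over totally real F: for every prime p ≥ 7 (ANY
ramification in F) there are reciprocity data RD, pinned by the conjoined known (A)-direction for
regular L-algebraic cuspidal π of GL₂/F AND by the labelled Hodge–Tate weights {−m} of every power
ε^m of the cyclotomic character at every v ∣ p and every ℚ_p-embedding (this second pin defeats junk
filtrations on RD.pst.𝔅 — e.g. Fil^i = B for i ≤ 0, 0 for i > 0 — that would make the regularity
hypothesis unsatisfiable and the slice vacuous), such that every irreducible, geometric, totally odd
ρ : G_F → GL₂(ℚ̄_p) which at every v ∣ p is crystalline (de Rham, WD unramified, N = 0 through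
RD.pst) with multiplicity-free τ-labelled Hodge–Tate weights of cardinality 2 for every
ℚ_p-embedding τ, whose residual restriction at every v ∣ p is generic (no trace congruence to χ₁ +
χ₂ with χ₁χ₂⁻¹ ≡ 1 or ≡ ε), with ρ̄|G_{F(ζ_p)} absolutely irreducible and ρ̄ ≡ ρ₀ for the ρ₀ of a
regular L-algebraic cuspidal π₀, corresponds (Corresponds RD ι π ρ) to an L-algebraic cuspidal π. -/
@[route_item "route-Langlands-TriangulineChamber", crux]
def LiftB2CrysGeneric : Prop :=
  ∀ (F : Type) [Field F] [NumberField F] [NumberField.IsTotallyReal F] (p : ℕ) [Fact p.Prime], 7 ≤ p → ∃ RD : ReciprocityData F, (∀ (m : ℤ) (χ : Literature.NumberTheory.GaloisRepresentations.FramedGaloisRep F (PadicAlgCl p) 1), (∀ σ, (χ σ).val 0 0 = algebraMap ℚ_[p] (PadicAlgCl p) ((((Literature.NumberTheory.GaloisRepresentations.GaloisRep.cyclotomicCharacter F p σ : ℤ_[p]ˣ) : ℤ_[p]) : ℚ_[p]) ^ m)) → ∀ (v : IsDedekindDomain.HeightOneSpectrum (NumberField.RingOfIntegers F)) (hv : ((p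 : ℕ) : NumberField.RingOfIntegers F) ∈ v.asIdeal), let D := RD.pst p v hv; letI := D.algebra; ∀ τ : v.adicCompletion F →ₐ[ℚ_[p]] PadicAlgCl p, χ.labelledHodgeTateWeightsAt v D.algebra D.𝔅 τ.toRingHom = {-m}) ∧ ∀ hcpt : Literature.NumberTheory.Automorphic.isCompact_glFiniteIntegralLevel 2 F, (∀ π : Literature.NumberTheory.Automorphic.CuspidalAutomorphicRepData 2 F hcpt, π.1.IsLAlgebraic → (∃ T : Literature.NumberTheory.Automorphic.InfinityType F 2, π.1.HasInfinityType T ∧ T.IsRegular) → ∀ (ℓ : ℕ) [Fact ℓ.Prime] (ι : PadicAlgCl ℓ ≃+* ℂ), ∃ ρ : Literature.NumberTheory.GaloisRepresentations.FramedGaloisRep F (PadicAlgCl ℓ) 2, ρ.toGaloisRep.IsIrreducible ∧ IsGeometricFramed RD ρ ∧ Corresponds RD ι π.1 ρ) ∧ (∀ (ι : PadicAlgCl p ≃+* ℂ) (ρ : Literature.NumberTheory.GaloisRepresentations.FramedGaloisRep F (PadicAlgCl p) 2), ρ.toGaloisRep.IsIrreducible → IsGeometricFramed RD ρ → ρ.IsOdd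 → (∀ (v : IsDedekindDomain.HeightOneSpectrum (NumberField.RingOfIntegers F)) (hv : ((p : ℕ) : NumberField.RingOfIntegers F) ∈ v.asIdeal), let D := RD.pst p v hv; D.IsCrystallineFramed (ρ.toLocal v) ∧ (letI := D.algebra; ∀ τ : v.adicCompletion F →ₐ[ℚ_[p]] PadicAlgCl p, let M := ρ.labelledHodgeTateWeightsAt v D.algebra D.𝔅 τ.toRingHom; M.Nodup ∧ Multiset.card M = 2)) → (∀ v : IsDedekindDomain.HeightOneSpectrum (NumberField.RingOfIntegers F), ((p : ℕ) : NumberField.RingOfIntegers F) ∈ v.asIdeal → ∀ χ₁ χ₂ : Field.absoluteGaloisGroup (v.adicCompletion F) →* (PadicAlgCl p)ˣ, IsOpen (χ₁.ker : Set (Field.absoluteGaloisGroup (v.adicCompletion F))) → IsOpen (χ₂.ker : Set (Field.absoluteGaloisGroup (v.adicCompletion F))) → (∀ σ, ‖(ρ.toLocal v σ).val.trace - ((χ₁ σ : PadicAlgCl p) + (χ₂ σ : PadicAlgCl p))‖ < 1) → (∃ σ, 1 ≤ ‖(χ₁ σ : PadicAlgCl p) * (χ₂ σ : PadicAlgCl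 p)⁻¹ - 1‖) ∧ (∃ σ, 1 ≤ ‖(χ₁ σ : PadicAlgCl p) * (χ₂ σ : PadicAlgCl p)⁻¹ - algebraMap ℚ_[p] (PadicAlgCl p) (((Literature.NumberTheory.GaloisRepresentations.GaloisRep.cyclotomicCharacter (v.adicCompletion F) p σ : ℤ_[p]ˣ) : ℤ_[p]) : ℚ_[p])‖)) → (¬ ∃ χ₁ χ₂ : Field.absoluteGaloisGroup (CyclotomicField p F) →* (PadicAlgCl p)ˣ, IsOpen (χ₁.ker : Set (Field.absoluteGaloisGroup (CyclotomicField p F))) ∧ IsOpen (χ₂.ker : Set (Field.absoluteGaloisGroup (CyclotomicField p F))) ∧ ∀ σ, ‖(ρ.restrictField (CyclotomicField p F) σ).val.trace - ((χ₁ σ : PadicAlgCl p) + (χ₂ σ : PadicAlgCl p))‖ < 1) → (∃ (π₀ : Literature.NumberTheory.Automorphic.CuspidalAutomorphicRepData 2 F hcpt) (ρ₀ : Literature.NumberTheory.GaloisRepresentations.FramedGaloisRep F (PadicAlgCl p) 2), π₀.1.IsLAlgebraic ∧ (∃ T : Literature.NumberTheory.Automorphic.InfinityType F 2, π₀.1.HasInfinityType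 T ∧ T.IsRegular) ∧ Corresponds RD ι π₀.1 ρ₀ ∧ ∀ σ, ‖(ρ σ).val.trace - (ρ₀ σ).val.trace‖ < 1) → ∃ π : Literature.NumberTheory.Automorphic.CuspidalAutomorphicRepData 2 F hcpt, π.1.IsLAlgebraic ∧ Corresponds RD ι π.1 ρ)

-- item stmt-Langlands-8599 · crux · rank 2 · open · by planner — informal only, no Lean statement yet:
--   [crux] (rank 2; the heart of the route; card one-chamber-per-type-trianguline, CORRECTED) IRR''(ρ̄,
--   t): let K/ℚ_p be finite, L/ℚ_p large, ρ̄ : G_K → GL₂(k_L) GENERIC (ρ̄^ss ≇ χ ⊕ χω^i for i ∈ {0, ±1}: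
--   absolutely irreducible, or reducible — split or not — with generic ratio). Let X_tri^□(ρ̄) ⊂ 𝔛^□_ρ̄
--   × 𝒯² be the Breuil–Hellmann–Schraen trianguline variety (arXiv:1411.7260 Déf 2.4; equidimensional of
--   dim 4 + 3[K:ℚ_p], U_tri^□(ρ̄)^reg smooth Zariski-open dense, Th 2.6), 𝒯² the rigid space of
--   continuous characters of (K×)², and for a torsion type t ∈ Hom(μ(K)², L×) = π₀(𝒯²) let X_t be the
--   union of

-- item stmt-Langlands-14538 · crux · rank 3 · open · by planner — informal only, no Lean statement yet:
--   [crux] (rank 3; REPAIRED ChamberQpOpenCases after crux-attack rattack-8601-0, class misstated: old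
--   claim (a) [split ρ̄] is a transfer lemma, now support ChamberQpSplit; old claim (b) said 'exactly
--   one … for every type', literally false at the det-incompatible types, whose fibre is EMPTY — now 'at
--   most one') IRR'' (item IrredChamberGL2) at K = ℚ_p for ρ̄ ABSOLUTELY IRREDUCIBLE: p ≥ 5, ρ̄ :
--   G_{ℚ_p} → GL₂(k), ρ̄|_{I_p} ≅ ω₂^s ⊕ ω₂^{ps}, (p+1) ∤ s (generic automatically). Let X = X_tri^□(ρ̄)
--   ⊂ 𝔛^□_ρ̄ × 𝒯² be the BHS trianguline variety (arXiv:1411.7260 Déf 2.4; equidimensional of dim 7,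
--   U^reg smoo

/-- item stmt-Langlands-8573 · crux · rank 4 · open · by planner
why it might fail: Unbounded weights at F_v = ℚ_{p^f}, f ≥ 3 (f = 2 off very generic) are beyond print: Matsumoto's classicality uses [F_v:ℚ_p] ≤ 2 crucially (Rem 1.1), Feng–Le Hung BM needs 2h_{λ+ρ}-generic tame types (small λ); IRR'' may fail for f ≥ 2 via partial-embedding invariants; ∃RD caveats as for 8572.
sources: arXiv:2512.04641, arXiv:2310.07006, arXiv:2005.14267, BreuilHellmannSchraen2019, Kisin2009
[crux] the target slice restricted to primes p UNRAMIFIED in F (¬ p ∣ disc F): every F_v is ℚ_{p^f};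
the first layer beyond print is f_v ≥ 3 (f_v = 1: Kisin2009; f_v = 2 very generic: Matsumoto
arXiv:2512.04641 Thm 1.2). In the mechanism this is the regime where torsion types are tame (μ(F_v)
= μ_{q−1}), Fontaine–Laffaille seeds exist in every residue class of weights, and halo/ghost
technology is partially available (Ren–Zhao arXiv:2005.14267). [difficulty: open-problem] -/
@[route_item "route-Langlands-TriangulineChamber", crux]
def LiftB2CrysUnramifiedP : Prop :=
  ∀ (F : Type) [Field F] [NumberField F] [NumberField.IsTotallyReal F] (p : ℕ) [Fact p.Prime], 7 ≤ p → ¬ ((p : ℤ) ∣ NumberField.discr F) → ∃ RD : ReciprocityData F, (∀ (m : ℤ) (χ : Literature.NumberTheory.GaloisRepresentations.FramedGaloisRep F (PadicAlgCl p) 1), (∀ σ, (χ σ).val 0 0 = algebraMap ℚ_[p] (PadicAlgCl p) ((((Literature.NumberTheory.GaloisRepresentations.GaloisRep.cyclotomicCharacter F p σ : ℤ_[p]ˣ) : ℤ_[p]) : ℚ_[p]) ^ m)) → ∀ (v : IsDedekindDomain.HeightOneSpectrum (NumberField.RingOfIntegers F)) (hv : ((p : ℕ) : NumberField.RingOfIntegers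 F) ∈ v.asIdeal), let D := RD.pst p v hv; letI := D.algebra; ∀ τ : v.adicCompletion F →ₐ[ℚ_[p]] PadicAlgCl p, χ.labelledHodgeTateWeightsAt v D.algebra D.𝔅 τ.toRingHom = {-m}) ∧ ∀ hcpt : Literature.NumberTheory.Automorphic.isCompact_glFiniteIntegralLevel 2 F, (∀ π : Literature.NumberTheory.Automorphic.CuspidalAutomorphicRepData 2 F hcpt, π.1.IsLAlgebraic → (∃ T : Literature.NumberTheory.Automorphic.InfinityType F 2, π.1.HasInfinityType T ∧ T.IsRegular) → ∀ (ℓ : ℕ) [Fact ℓ.Prime] (ι : PadicAlgCl ℓ ≃+* ℂ), ∃ ρ : Literature.NumberTheory.GaloisRepresentations.FramedGaloisRep F (PadicAlgCl ℓ) 2, ρ.toGaloisRep.IsIrreducible ∧ IsGeometricFramed RD ρ ∧ Corresponds RD ι π.1 ρ) ∧ (∀ (ι : PadicAlgCl p ≃+* ℂ) (ρ : Literature.NumberTheory.GaloisRepresentations.FramedGaloisRep F (PadicAlgCl p) 2), ρ.toGaloisRep.IsIrreducible → IsGeometricFramed RD ρ → ρ.IsOdd → (∀ (v : IsDedekindDomain.HeightOneSpectrum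 (NumberField.RingOfIntegers F)) (hv : ((p : ℕ) : NumberField.RingOfIntegers F) ∈ v.asIdeal), let D := RD.pst p v hv; D.IsCrystallineFramed (ρ.toLocal v) ∧ (letI := D.algebra; ∀ τ : v.adicCompletion F →ₐ[ℚ_[p]] PadicAlgCl p, let M := ρ.labelledHodgeTateWeightsAt v D.algebra D.𝔅 τ.toRingHom; M.Nodup ∧ Multiset.card M = 2)) → (∀ v : IsDedekindDomain.HeightOneSpectrum (NumberField.RingOfIntegers F), ((p : ℕ) : NumberField.RingOfIntegers F) ∈ v.asIdeal → ∀ χ₁ χ₂ : Field.absoluteGaloisGroup (v.adicCompletion F) →* (PadicAlgCl p)ˣ, IsOpen (χ₁.ker : Set (Field.absoluteGaloisGroup (v.adicCompletion F))) → IsOpen (χ₂.ker : Set (Field.absoluteGaloisGroup (v.adicCompletion F))) → (∀ σ, ‖(ρ.toLocal v σ).val.trace - ((χ₁ σ : PadicAlgCl p) + (χ₂ σ : PadicAlgCl p))‖ < 1) → (∃ σ, 1 ≤ ‖(χ₁ σ : PadicAlgCl p) * (χ₂ σ : PadicAlgCl p)⁻¹ - 1‖) ∧ (∃ σ, 1 ≤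 ‖(χ₁ σ : PadicAlgCl p) * (χ₂ σ : PadicAlgCl p)⁻¹ - algebraMap ℚ_[p] (PadicAlgCl p) (((Literature.NumberTheory.GaloisRepresentations.GaloisRep.cyclotomicCharacter (v.adicCompletion F) p σ : ℤ_[p]ˣ) : ℤ_[p]) : ℚ_[p])‖)) → (¬ ∃ χ₁ χ₂ : Field.absoluteGaloisGroup (CyclotomicField p F) →* (PadicAlgCl p)ˣ, IsOpen (χ₁.ker : Set (Field.absoluteGaloisGroup (CyclotomicField p F))) ∧ IsOpen (χ₂.ker : Set (Field.absoluteGaloisGroup (CyclotomicField p F))) ∧ ∀ σ, ‖(ρ.restrictField (CyclotomicField p F) σ).val.trace - ((χ₁ σ : PadicAlgCl p) + (χ₂ σ : PadicAlgCl p))‖ < 1) → (∃ (π₀ : Literature.NumberTheory.Automorphic.CuspidalAutomorphicRepData 2 F hcpt) (ρ₀ : Literature.NumberTheory.GaloisRepresentations.FramedGaloisRep F (PadicAlgCl p) 2), π₀.1.IsLAlgebraic ∧ (∃ T : Literature.NumberTheory.Automorphic.InfinityType F 2, π₀.1.HasInfinityType T ∧ T.IsRegular) ∧ Corresponds RD ι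 π₀.1 ρ₀ ∧ ∀ σ, ‖(ρ σ).val.trace - (ρ₀ σ).val.trace‖ < 1) → ∃ π : Literature.NumberTheory.Automorphic.CuspidalAutomorphicRepData 2 F hcpt, π.1.IsLAlgebraic ∧ Corresponds RD ι π.1 ρ)

/-- item stmt-Langlands-8574 · crux · rank 5 · open · by planner
why it might fail: Ramified F_v: BM known only for pot-BT types (GeeKisin2014, EG2022 §8.6); Matsumoto/Feng–Le Hung need F_v unramified; if ζ_p ∈ F_v types get a μ_{p^∞}-part and OrdinaryComponent's H²(G_K,k)=0 fails (8607 notes), so chambers/seeds go per det-component; Breuil–Kisin lattice invariants may split a type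
sources: GeeKisin2014, EmertonGee2022, arXiv:2110.01638, arXiv:2512.04641, arXiv:2310.07006, BreuilHellmannSchraen2017Trianguline
[crux] the target slice for primes p RAMIFIED in F (p ∣ disc F): some F_v/ℚ_p is ramified; here
Breuil–Mézard is known only for potentially Barsotti–Tate types (GeeKisin2014), the perfectoid
classicality method uses unramifiedness crucially (arXiv:2512.04641 Rem 1.1), and torsion types
acquire a μ_{p^∞}(F_v)-part (matching the determinant components of the framed deformation ring,
Böckle–Iyengar–Paškūnas arXiv:2110.01638). [difficulty: open-problem] -/
@[route_item "route-Langlands-TriangulineChamber", crux]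
def LiftB2CrysRamifiedP : Prop :=
  ∀ (F : Type) [Field F] [NumberField F] [NumberField.IsTotallyReal F] (p : ℕ) [Fact p.Prime], 7 ≤ p → ((p : ℤ) ∣ NumberField.discr F) → ∃ RD : ReciprocityData F, (∀ (m : ℤ) (χ : Literature.NumberTheory.GaloisRepresentations.FramedGaloisRep F (PadicAlgCl p) 1), (∀ σ, (χ σ).val 0 0 = algebraMap ℚ_[p] (PadicAlgCl p) ((((Literature.NumberTheory.GaloisRepresentations.GaloisRep.cyclotomicCharacter F p σ : ℤ_[p]ˣ) : ℤ_[p]) : ℚ_[p]) ^ m)) → ∀ (v : IsDedekindDomain.HeightOneSpectrum (NumberField.RingOfIntegers F)) (hv : ((p : ℕ) : NumberField.RingOfIntegers F) ∈ v.asIdeal), let D := RD.pst p v hv; letI := D.algebra; ∀ τ : v.adicCompletion F →ₐ[ℚ_[p]] PadicAlgCl p, χ.labelledHodgeTateWeightsAt v D.algebra D.𝔅 τ.toRingHom = {-m}) ∧ ∀ hcpt : Literature.NumberTheory.Automorphic.isCompact_glFiniteIntegralLevel 2 F, (∀ π : Literature.NumberTheory.Automorphic.CuspidalAutomorphicRepData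 2 F hcpt, π.1.IsLAlgebraic → (∃ T : Literature.NumberTheory.Automorphic.InfinityType F 2, π.1.HasInfinityType T ∧ T.IsRegular) → ∀ (ℓ : ℕ) [Fact ℓ.Prime] (ι : PadicAlgCl ℓ ≃+* ℂ), ∃ ρ : Literature.NumberTheory.GaloisRepresentations.FramedGaloisRep F (PadicAlgCl ℓ) 2, ρ.toGaloisRep.IsIrreducible ∧ IsGeometricFramed RD ρ ∧ Corresponds RD ι π.1 ρ) ∧ (∀ (ι : PadicAlgCl p ≃+* ℂ) (ρ : Literature.NumberTheory.GaloisRepresentations.FramedGaloisRep F (PadicAlgCl p) 2), ρ.toGaloisRep.IsIrreducible → IsGeometricFramed RD ρ → ρ.IsOdd → (∀ (v : IsDedekindDomain.HeightOneSpectrum (NumberField.RingOfIntegers F)) (hv : ((p : ℕ) : NumberField.RingOfIntegers F) ∈ v.asIdeal), let D := RD.pst p v hv; D.IsCrystallineFramed (ρ.toLocal v) ∧ (letI := D.algebra; ∀ τ : v.adicCompletion F →ₐ[ℚ_[p]] PadicAlgCl p, let M := ρ.labelledHodgeTateWeightsAt v D.algebra D.𝔅 τ.toRingHom; M.Nodup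 ∧ Multiset.card M = 2)) → (∀ v : IsDedekindDomain.HeightOneSpectrum (NumberField.RingOfIntegers F), ((p : ℕ) : NumberField.RingOfIntegers F) ∈ v.asIdeal → ∀ χ₁ χ₂ : Field.absoluteGaloisGroup (v.adicCompletion F) →* (PadicAlgCl p)ˣ, IsOpen (χ₁.ker : Set (Field.absoluteGaloisGroup (v.adicCompletion F))) → IsOpen (χ₂.ker : Set (Field.absoluteGaloisGroup (v.adicCompletion F))) → (∀ σ, ‖(ρ.toLocal v σ).val.trace - ((χ₁ σ : PadicAlgCl p) + (χ₂ σ : PadicAlgCl p))‖ < 1) → (∃ σ, 1 ≤ ‖(χ₁ σ : PadicAlgCl p) * (χ₂ σ : PadicAlgCl p)⁻¹ - 1‖) ∧ (∃ σ, 1 ≤ ‖(χ₁ σ : PadicAlgCl p) * (χ₂ σ : PadicAlgCl p)⁻¹ - algebraMap ℚ_[p] (PadicAlgCl p) (((Literature.NumberTheory.GaloisRepresentations.GaloisRep.cyclotomicCharacter (v.adicCompletion F) p σ : ℤ_[p]ˣ) : ℤ_[p]) : ℚ_[p])‖)) → (¬ ∃ χ₁ χ₂ : Field.absoluteGaloisGroup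 (CyclotomicField p F) →* (PadicAlgCl p)ˣ, IsOpen (χ₁.ker : Set (Field.absoluteGaloisGroup (CyclotomicField p F))) ∧ IsOpen (χ₂.ker : Set (Field.absoluteGaloisGroup (CyclotomicField p F))) ∧ ∀ σ, ‖(ρ.restrictField (CyclotomicField p F) σ).val.trace - ((χ₁ σ : PadicAlgCl p) + (χ₂ σ : PadicAlgCl p))‖ < 1) → (∃ (π₀ : Literature.NumberTheory.Automorphic.CuspidalAutomorphicRepData 2 F hcpt) (ρ₀ : Literature.NumberTheory.GaloisRepresentations.FramedGaloisRep F (PadicAlgCl p) 2), π₀.1.IsLAlgebraic ∧ (∃ T : Literature.NumberTheory.Automorphic.InfinityType F 2, π₀.1.HasInfinityType T ∧ T.IsRegular) ∧ Corresponds RD ι π₀.1 ρ₀ ∧ ∀ σ, ‖(ρ σ).val.trace - (ρ₀ σ).val.trace‖ < 1) → ∃ π : Literature.NumberTheory.Automorphic.CuspidalAutomorphicRepData 2 F hcpt, π.1.IsLAlgebraic ∧ Corresponds RD ι π.1 ρ)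

/-- item stmt-Langlands-9516 · crux · rank 9 · open · by planner
why it might fail: It is the REST of GL_n reciprocity (Fontaine–Mazur, automorphy of every irreducible geometric ρ, Galois representations for every algebraic π; all n, all number fields): wide open; the typed `Langlands` may be over-strong in corners (irregular π, even ρ). Out-of-scope remainder, held, not staffed.
sources: BuzzardGeeLMS2014, BreuilHellmannSchraen2017Trianguline, Kisin2009
[support] OUT-OF-SCOPE REMAINDER (route-repair rrepair-Langlands-TriangulineChamber-3adfee79; D-0027
§2.1 layer invariant), filed only so that the route's glue can honestly end at the summit:
LiftB2CrysGeneric → Langlands. It contains everything this thesis does not claim — direction (A) and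
the reciprocity data 𝓡 for every number field, n ≠ 2, non-totally-real F, even /
non-crystalline-at-p / non-generic / residually small or residually non-automorphic ρ, p < 7 — i.e.
the rest of GL_n reciprocity (same pattern as CapacityClassicality.SectorToLanglands,
DegenerateLimits.LanglandsOfTarget, QuadraticWindow.BeyondTheWindow). Not to be staffed from this
route. With it the deciding theorem is `theorem closes : LiftB2CrysGeneric → LiftB2CrysUnramifiedP →
LiftB2CrysRamifiedP → LiftB2CrysSplitP → WallLemma → SliceToLanglands → ReciprocityDataInputs →
Assembly → _root_.Langlands := fun hG _ _ _ _ hJ _ _ => hJ hG` (with the current Assembly) — checked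
in the repair planner's Sketch.lean, rc 0, axioms propext / Classical.choice / Quot.sound; to be
installed by an authorised `route edit --closes-file` (this repair seat's `route edit` calls are
refused: 'only the route's planner … or the operat -/
@[route_item "route-Langlands-TriangulineChamber", crux]
def SliceToLanglands : Prop :=
  LiftB2CrysGeneric → _root_.Langlands

-- item stmt-Langlands-8601 · support · rank 3 · open · by planner — informal only, no Lean statement yet:
--   [crux] (rank 3; calibration rung and cheapest kill) IRR'' (item IrredChamberGL2) for K = ℚ_p in the
--   two residual cases that Liu–Truong–Xiao–Zhao leave open. (a) SPLIT GENERIC: ρ̄ = χ̄₁ ⊕ χ̄₂ : G_{ℚ_p}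
--   → GL₂(𝔽), χ̄₁χ̄₂⁻¹|_{I_p} = ω^{a+1} with 2 ≤ a ≤ p−5, p ≥ 11. By LTXZ II (arXiv:2302.07697 §9: Lemma
--   'ordinary factorization', Theorem 'irreducible factors', Corollary 'irreducible components') the
--   non-ordinary spectral curve of an 𝒪⟦K_p⟧-projective arithmetic module of type ρ̄ and character ε of
--   (𝔽_p×)² has finitely many irreducible components, each of ghost type, with total multiplicity m; for

-- item stmt-Langlands-14533 · support · rank 9 · open · by planner — informal only, no Lean statement yet:
--   [support] (TRANSFER LEMMA nonsplit ⇒ split at K = ℚ_p; replaces claim (a) of the former crux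
--   ChamberQpOpenCases after crux-attack rattack-8601-0: the local chamber statement for split ρ̄
--   REDUCES to ChamberQpNonsplit and is independent of LTXZ II Rem 146, an m = 2 arithmetic-module
--   question without local object — arXiv:2302.07697 Assumption 123, Rem 122(2)) Let p > 2 and ρ̄ = χ̄₁
--   ⊕ χ̄₂ : G_{ℚ_p} → GL₂(k) be split GENERIC (χ̄₁χ̄₂⁻¹ ∉ {1, ω^{±1}}); then dim_k Ext¹(χ̄₂, χ̄₁) =
--   dim_k Ext¹(χ̄₁, χ̄₂) = 1, so ρ̄ has exactly two nonsplit companions up to isomorphism, r̄₁₂ (stable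
--   line χ̄₁) and r̄₂₁ (st

/-- item stmt-Langlands-8575 · support · rank 9 · open · by planner
sources: Kisin2009, CaraianiEtAl2016, Emerton2011LocalGlobal
[support] the target slice when p SPLITS COMPLETELY in F (every F_v = ℚ_p): KNOWN in print — Kisin's
Fontaine–Mazur theorem for GL₂ over totally real fields in which p splits completely (via
Breuil–Mézard for GL₂(ℚ_p) and Colmez's functor; the residual genericity here excludes exactly
Kisin's bad cases). Calibration anchor and formal sanity target (it is a specialisation of
LiftB2CrysGeneric, proved in Sketch.lean: splitP_of_generic). [difficulty: XL] -/
@[route_item "route-Langlands-TriangulineChamber"]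
def LiftB2CrysSplitP : Prop :=
  ∀ (F : Type) [Field F] [NumberField F] [NumberField.IsTotallyReal F] (p : ℕ) [Fact p.Prime], 7 ≤ p → (∀ v : IsDedekindDomain.HeightOneSpectrum (NumberField.RingOfIntegers F), ((p : ℕ) : NumberField.RingOfIntegers F) ∈ v.asIdeal → v.residueCard = p ∧ ¬ v.asIdeal ^ 2 ∣ Ideal.span {((p : ℕ) : NumberField.RingOfIntegers F)}) → ∃ RD : ReciprocityData F, (∀ (m : ℤ) (χ : Literature.NumberTheory.GaloisRepresentations.FramedGaloisRep F (PadicAlgCl p) 1), (∀ σ, (χ σ).val 0 0 = algebraMap ℚ_[p] (PadicAlgCl p) ((((Literature.NumberTheory.GaloisRepresentations.GaloisRep.cyclotomicCharacter F p σ : ℤ_[p]ˣ) : ℤ_[p]) : ℚ_[p]) ^ m)) → ∀ (v : IsDedekindDomain.HeightOneSpectrum (NumberField.RingOfIntegers F)) (hv : ((p : ℕ) : NumberField.RingOfIntegers F) ∈ v.asIdeal), let D := RD.pst p v hv; letI := D.algebra; ∀ τ : v.adicCompletion F →ₐ[ℚ_[p]] PadicAlgCl p, χ.labelledHodgeTateWeightsAt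 v D.algebra D.𝔅 τ.toRingHom = {-m}) ∧ ∀ hcpt : Literature.NumberTheory.Automorphic.isCompact_glFiniteIntegralLevel 2 F, (∀ π : Literature.NumberTheory.Automorphic.CuspidalAutomorphicRepData 2 F hcpt, π.1.IsLAlgebraic → (∃ T : Literature.NumberTheory.Automorphic.InfinityType F 2, π.1.HasInfinityType T ∧ T.IsRegular) → ∀ (ℓ : ℕ) [Fact ℓ.Prime] (ι : PadicAlgCl ℓ ≃+* ℂ), ∃ ρ : Literature.NumberTheory.GaloisRepresentations.FramedGaloisRep F (PadicAlgCl ℓ) 2, ρ.toGaloisRep.IsIrreducible ∧ IsGeometricFramed RD ρ ∧ Corresponds RD ι π.1 ρ) ∧ (∀ (ι : PadicAlgCl p ≃+* ℂ) (ρ : Literature.NumberTheory.GaloisRepresentations.FramedGaloisRep F (PadicAlgCl p) 2), ρ.toGaloisRep.IsIrreducible → IsGeometricFramed RD ρ → ρ.IsOdd → (∀ (v : IsDedekindDomain.HeightOneSpectrum (NumberField.RingOfIntegers F)) (hv : ((p : ℕ) : NumberField.RingOfIntegers F) ∈ v.asIdeal), let D := RD.pst p v hv; D.IsCrystallineFramed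 (ρ.toLocal v) ∧ (letI := D.algebra; ∀ τ : v.adicCompletion F →ₐ[ℚ_[p]] PadicAlgCl p, let M := ρ.labelledHodgeTateWeightsAt v D.algebra D.𝔅 τ.toRingHom; M.Nodup ∧ Multiset.card M = 2)) → (∀ v : IsDedekindDomain.HeightOneSpectrum (NumberField.RingOfIntegers F), ((p : ℕ) : NumberField.RingOfIntegers F) ∈ v.asIdeal → ∀ χ₁ χ₂ : Field.absoluteGaloisGroup (v.adicCompletion F) →* (PadicAlgCl p)ˣ, IsOpen (χ₁.ker : Set (Field.absoluteGaloisGroup (v.adicCompletion F))) → IsOpen (χ₂.ker : Set (Field.absoluteGaloisGroup (v.adicCompletion F))) → (∀ σ, ‖(ρ.toLocal v σ).val.trace - ((χ₁ σ : PadicAlgCl p) + (χ₂ σ : PadicAlgCl p))‖ < 1) → (∃ σ, 1 ≤ ‖(χ₁ σ : PadicAlgCl p) * (χ₂ σ : PadicAlgCl p)⁻¹ - 1‖) ∧ (∃ σ, 1 ≤ ‖(χ₁ σ : PadicAlgCl p) * (χ₂ σ : PadicAlgCl p)⁻¹ - algebraMap ℚ_[p] (PadicAlgCl p) (((Literature.NumberTheory.GaloisRepresentations.GaloisRep.cyclotomicCharacter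 (v.adicCompletion F) p σ : ℤ_[p]ˣ) : ℤ_[p]) : ℚ_[p])‖)) → (¬ ∃ χ₁ χ₂ : Field.absoluteGaloisGroup (CyclotomicField p F) →* (PadicAlgCl p)ˣ, IsOpen (χ₁.ker : Set (Field.absoluteGaloisGroup (CyclotomicField p F))) ∧ IsOpen (χ₂.ker : Set (Field.absoluteGaloisGroup (CyclotomicField p F))) ∧ ∀ σ, ‖(ρ.restrictField (CyclotomicField p F) σ).val.trace - ((χ₁ σ : PadicAlgCl p) + (χ₂ σ : PadicAlgCl p))‖ < 1) → (∃ (π₀ : Literature.NumberTheory.Automorphic.CuspidalAutomorphicRepData 2 F hcpt) (ρ₀ : Literature.NumberTheory.GaloisRepresentations.FramedGaloisRep F (PadicAlgCl p) 2), π₀.1.IsLAlgebraic ∧ (∃ T : Literature.NumberTheory.Automorphic.InfinityType F 2, π₀.1.HasInfinityType T ∧ T.IsRegular) ∧ Corresponds RD ι π₀.1 ρ₀ ∧ ∀ σ, ‖(ρ σ).val.trace - (ρ₀ σ).val.trace‖ < 1) → ∃ π : Literature.NumberTheory.Automorphic.CuspidalAutomorphicRepData 2 F hcpt, π.1.IsLAlgebraic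 ∧ Corresponds RD ι π.1 ρ)

/-- item stmt-Langlands-8576 · support · rank 9 · closed · proved by Summit.Langlands.Langlands.Theorems.WallLemma.WallLemma_proof (prover) · by planner
sources: BreuilHellmannSchraen2017Trianguline, KedlayaPottharstXiao2014
[support] the adic WALL LEMMA behind the comb picture of the card (P1a): a Laurent series Σ a_n z^n
over a complete ultrametric field, power-bounded by 1 on the OPEN annulus r < |z| < 1 (sup over r <
s < 1 of ‖a_n‖ s^n ≤ 1), has constant reduction there: ‖f(x) − a_0‖ < 1 for every r < ‖x‖ < 1 (so
ρ̄^ss, read through bounded analytic traces, is constant on chambers and the reduction walls of the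
fixed-weight charts sit at removed Gauss points). Mathlib-sized
(NonarchimedeanAddGroup.summable_of_tendsto_cofinite_zero + ultrametric tsum bound); explanatory,
not load-bearing for the Assembly. [difficulty: provable-now] -/
@[route_item "route-Langlands-TriangulineChamber"]
def WallLemma : Prop :=
  ∀ (C : Type) [NontriviallyNormedField C] [IsUltrametricDist C] [CompleteSpace C] (a : ℤ → C) (r : ℝ), 0 ≤ r → r < 1 → (∀ s : ℝ, r < s → s < 1 → ∀ n : ℤ, ‖a n‖ * s ^ n ≤ 1) → ∀ x : C, r < ‖x‖ → ‖x‖ < 1 → Summable (fun n : ℤ => a n * x ^ n) ∧ ‖(∑' n : ℤ, a n * x ^ n) - a 0‖ < 1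

/-- `WallLemma` holds: proved by `Summit.Langlands.Langlands.Theorems.WallLemma.WallLemma_proof`. -/
theorem WallLemma_holds : WallLemma := _root_.Summit.Langlands.Langlands.Theorems.WallLemma.WallLemma_proof

-- item stmt-Langlands-8606 · support · rank 9 · open · by planner — informal only, no Lean statement yet:
--   [support] (known in print modulo a dictionary; the positive calibration of the line) IRR'' (item
--   IrredChamberGL2) for K = ℚ_p, ρ̄ : G_{ℚ_p} → GL₂(𝔽) reducible NONSPLIT and very generic (ρ̄|_{I_p} ≅
--   (ω^{a+b+1} ∗; 0 ω^b), 2 ≤ a ≤ p−5, p ≥ 11): for every character ε of (𝔽_p×)² (= torsion type), the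
--   positive-slope part of X_tri^□(ρ̄)|_ε is irreducible. In print: LTXZ II arXiv:2302.07697 §9 — Lemma
--   'ordinary factorization' (the characteristic power series of U_p on the abstract overconvergent
--   forms of an 𝒪⟦K_p⟧-projective arithmetic module H̃ of type ρ̄ factors as C_nord · C_ord), Theorem
--   'irreduci

-- item stmt-Langlands-8607 · support · rank 9 · open · by planner — informal only, no Lean statement yet:
--   [support] (the structural fact behind the correction of the card; theorem-level, provable in print
--   terms) Let K/ℚ_p be finite, ρ̄ : G_K → GL₂(k) generic reducible with a G_K-stable line ℓ (one line
--   if ρ̄ is nonsplit, two if split with χ̄₁ ≠ χ̄₂). (1) The functor of B_ℓ-valued framed lifts of ρ̄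
--   (B_ℓ the Borel stabilising ℓ, frame moving in G/B) is formally smooth over 𝒪_L: H²(G_K, ad 𝔟̄_ℓ) = 0
--   because its graded pieces are H²(k) = 0 (p > 2) and H²(χ̄_sub χ̄_quot⁻¹) = 0 (genericity: ratio ≠ ω,
--   local Tate duality); its rigid generic fibre is therefore a connected smooth space of dimension dim
--   𝔟·

-- item stmt-Langlands-8609 · support · rank 9 · open · by planner — informal only, no Lean statement yet:
--   [support] (SEEDS: one automorphic point on every relevant chamber; in print modulo bookkeeping — the
--   card's K3 downgraded from crux to support) Setting of BHS arXiv:1411.7260 §3: F/F⁺ CM unramified at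
--   finite places, every v ∣ p of F⁺ split in F, G definite unitary in 2 variables quasi-split at finite
--   places, p ≥ 7, U^p small and hyperspecial at p, S = S_p ∪ {v₁} (Rem 3.23(i): 𝔛^□_{ρ̄^p} smooth
--   irreducible), ρ̄ : G_F → GL₂(k) automorphic of tame level U^p, ρ̄(G_{F(ζ_p)}) adequate, ρ̄_ṽ GENERIC
--   for all v ∣ p. For each v ∣ p fix a prescription: ('B', a stable line ℓ_v of ρ̄_ṽ) or ('G', a
--   torsion

/-- item stmt-Langlands-9501 · support · rank 9 · open · by planner
[support] NEEDS-FACT CARRIER (route-repair rrepair-Langlands-TriangulineChamber-3adfee79; same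
statement as WachCensus.ReciprocityDataInputs, stmt-Langlands-3347) for the ∃-RD items of this
route. needs-fact: Literature.NumberTheory.Automorphic.LocalLanglandsDatum.nonempty ; needs-fact:
Literature.NumberTheory.GaloisRepresentations.PstWeilDeligneData.nonempty ; needs-fact:
Literature.NumberTheory.Automorphic.exists_galoisRep_of_regularAlgebraic (partial input of the (A)₂
pin only: the pin also needs irreducibility, geometricity and local–global compatibility at every
place for regular GL₂ Hilbert forms, not a tree fact yet). The first two are the named Literature
facts — local Langlands for GL_n of every completion F_v (Harris–Taylor 2001 Thm A; Henniart 2000)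
and Fontaine's B_dR / WD∘D_pst datum at v ∣ ℓ (Astérisque 223, Exp. III and VIII) — without which no
term of `ReciprocityData F` exists, hence without which LiftB2CrysGeneric / LiftB2CrysUnramifiedP /
LiftB2CrysRamifiedP / LiftB2CrysSplitP (shape `∃ RD, pins ∧ (A)₂ ∧ slice`) are formally unprovable
whatever happens to IRR''. Both are UNPROVED (no qualified `_holds`; short-name `nonempty_holds`
matches in FluidPDE/UniversalMac -/
@[route_item "route-Langlands-TriangulineChamber"]
def ReciprocityDataInputs : Prop :=
  Literature.NumberTheory.Automorphic.LocalLanglandsDatum.nonempty ∧ Literature.NumberTheory.GaloisRepresentations.PstWeilDeligneData.nonempty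

/-- item stmt-Langlands-8577 · assembly · rank 1 · closed · proved by Summit.Langlands.Langlands.Theorems.TriangulineChamber.Assembly_proof (prover) · by planner
sources: BreuilHellmannSchraen2017Trianguline, BarnetlambEtAl2014
[assembly] LiftB2CrysUnramifiedP → LiftB2CrysRamifiedP → LiftB2CrysGeneric (by_cases on p ∣ disc F). -/
@[route_item "route-Langlands-TriangulineChamber"]
def Assembly : Prop :=
  LiftB2CrysUnramifiedP → LiftB2CrysRamifiedP → LiftB2CrysGeneric

-- records of items no longer active in this route (dropped / restated):
-- earlier Assembly2 (stmt-Langlands-8610, dropped 2026-08-16T14:43:07Z): moot by None — [support] (the MATHEMATICAL assembly; every arrow in print except the input IrredChamberGL2) CLAIM: IrredChamberGL2 ∧ OrdinaryComponent ∧ TypeSeeds ⇒ the typed slices LiftB2CrysUnramifiedP, LiftB2CrysRamifiedP (hence LiftB2CrysGeneric), modulo the genuine reciprocity datum (nonempty facts + direction (A) for regu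

/-! D-0027 §2.1 — DECIDING THEOREM (planner-authored via `route open/edit --closes-file`; by planner-rrefute-Langlands-TriangulineChamber-s-a996770a-0 2026-08-16T04:08:24Z):
its hypotheses are this route's items and its conclusion the sub-problem Statement (glue_lint), and it elaborates with this file. -/

/-- D-0027 §2.1 deciding theorem of route TriangulineChamber (crux-only form, 2026-08-16): hypotheses =
the route's typed CRUX items only — the target slice `LiftB2CrysGeneric` (conjecture-grade, badged crux
by the gate), the two slices `LiftB2CrysUnramifiedP` / `LiftB2CrysRamifiedP` that partition it by
`p ∣ disc F`, and the declared out-of-scope remainder `SliceToLanglands : LiftB2CrysGeneric → Langlands`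
(the rest of GL_n reciprocity, re-badged crux because only cruxes may be hypotheses; not claimed by the
thesis).  The informal cruxes IrredChamberGL2 / ChamberQpIrreducible have no Lean decl and feed the typed
slices mathematically (support BHSChamberAssembly).  The former bookkeeping item `Assembly`
(`LiftB2CrysUnramifiedP → LiftB2CrysRamifiedP → LiftB2CrysGeneric`) is no longer a hypothesis: its
content — the case split on `p ∣ disc F` — is carried out inside the proof term. -/
@[closes "route-Langlands-TriangulineChamber"] theorem closes (_hG : LiftB2CrysGeneric) (hU : LiftB2CrysUnramifiedP) (hR : LiftB2CrysRamifiedP)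
    (hJ : SliceToLanglands) : _root_.Langlands := by
  refine hJ ?_
  intro F _ _ _ p _ hp
  by_cases h : ((p : ℤ) ∣ NumberField.discr F)
  · exact hR F p hp h
  · exact hU F p hp h

end Summit.Langlands.Langlands.Theses.TriangulineChamber
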